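import Summits.SmoothPoincare4.SmoothPoincare4.Theorems.SullivanDualWitnessChargeReductionV18

/-!
# Route item `PencilLocalFamilyOfNormalTransfer` (stmt-SmoothPoincare4-18051), closed

The glue item `Theses.SullivanDual.PencilLocalFamilyOfNormalTransfer :
NormalWitnessTransfer → LocalFoliationEmbeddedSpheres → PencilLocalFamily` (route-choice
rchoice-7e333091: the v16 assembly re-routed around the `J`-curve half of adjunction) is
`helper_pencilLocalFamily_of_hls_nwt` (crux `WitnessCharge`, line `Sketch`, reduction v18) with its
two hypotheses swapped.
-/

set_option linter.dupNamespace false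

namespace Summit.SmoothPoincare4.SmoothPoincare4.Theorems

/-- **Route item `PencilLocalFamilyOfNormalTransfer` (stmt-SmoothPoincare4-18051).** -/
theorem pencilLocalFamilyOfNormalTransfer_proof :
    Summit.SmoothPoincare4.SmoothPoincare4.Theses.SullivanDual.PencilLocalFamilyOfNormalTransfer :=
  fun hN hL => WitnessCharge.PencilIncompleteness.helper_pencilLocalFamily_of_hls_nwt hL hN

end Summit.SmoothPoincare4.SmoothPoincare4.Theorems
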